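import Summits.BirchSwinnertonDyer.Rank1Residual.Additive.X3BranchLayerTwoField
import Summits.BirchSwinnertonDyer.Rank1Residual.Additive.X3BranchLayerKummerZeta27
import Summits.BirchSwinnertonDyer.Rank1Residual.Additive.X3BranchLayerOneField
import HarnessLib

/-!
# X3, the DEGENERATE rows OFF the sub-locus, LAYER TWO: `ℚ(θ₂) = ℚ_2` is the WHOLE second layer
# (`[ℚ(θ₂) : ℚ] = 9`), the nonic `f₉ = X⁹ − 9X⁷ + 27X⁵ − 30X³ + 9X + 1` is the minimal polynomial of
# `θ₂ = ζ₂₇ + ζ₂₇⁻¹`, identities in `ℤ[θ₂]` transfer modulo `q` to every root of `f₉ (mod q)`, and an element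
# fixed by `κ⁻¹(9ℤ₃)` is an integer combination of `1, θ₂, …, θ₂⁸` over a denominator (cell `bsd-eis`,
# seat `bsd-eis-x3` gen 8; the layer-`2` analogue of gen 7's `X3BranchLayerOneField.lean`; route K1
# `AdditiveBranchIMC`, crux `GordTwoRankZeroOffCaseOne` — supports only)

HONEST FRAMING (`run/shared/lean/pub/bsd-eis/README.md` §4): THEOREMS ONLY (no `def`, no named fact,
no `sorry`); nothing is booked; no label, tier or count of record moves.

* `eq_or_mul_eq_one_of_add_inv_eq` — `x + x⁻¹ = y + y⁻¹ ⟹ x = y ∨ xy = 1`: the test used for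
* `exists_mem_layerSubgroup_one_smul_theta27_ne` — `θ₂ ∉ ℚ_1` (`γ³`, for a generator `γ` fixing `ζ₃`,
  moves `ζ₂₇`, gen 8's `LayerCharTower.pow_three_smul_zeta27_ne`, hence moves `θ₂`);
* `finrank_adjoin_theta27` / `adjoin_theta27_eq_layer_two` — `3 ∣ [ℚ(θ₂):ℚ] ∣ 9` (`ℚ(θ₁) ≤ ℚ(θ₂) ≤ ℚ_2`,
  `θ₁ = θ₂³ − 3θ₂`) and `≠ 3`, so `= 9` and `ℚ(θ₂) = ℚ_2`;
* `minpoly_rat_theta27`, `minpoly_int_theta27`, `eval₂_eq_of_aeval_eq_theta27` (transfer mod `q`);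
* `exists_intCombination9_of_fixed` — `γ` fixed by `κ.layerSubgroup 2` ⟹ `m γ = Σ_{k<9} g_k θ₂^k`, `m ≥ 1`.
References: [Washington1997] §2, §13.1; [Marcus2018] Ch. 3 (method).
-/

set_option autoImplicit false

noncomputable section

open scoped Classical

namespace Summit.BirchSwinnertonDyer.Rank1Residual.Additive

namespace LayerTwoField

open Field Polynomial IntermediateField Finset
open Literature.NumberTheory.GaloisRepresentations
open Literature.NumberTheory.EllipticCurves
open Summit.BirchSwinnertonDyer.Rank1Residual.Iwasawa.CyclotomicLayerOne

/-! ### §1 `θ₂ ∉ ℚ_1` -/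

/-- `x + x⁻¹ = y + y⁻¹` with `x, y ≠ 0` forces `x = y` or `x·y = 1`. [folklore] -/
theorem eq_or_mul_eq_one_of_add_inv_eq {F : Type*} [Field F] {x y : F} (hx : x ≠ 0) (hy : y ≠ 0)
    (h : x + x⁻¹ = y + y⁻¹) : x = y ∨ x * y = 1 := by
  have key : (x - y) * (x * y - 1) = 0 := by
    field_simp at h
    linear_combination h
  rcases mul_eq_zero.mp key with h1 | h1
  · exact Or.inl (sub_eq_zero.mp h1)
  · exact Or.inr (sub_eq_zero.mp h1)

/-- **`θ₂ = ζ₂₇ + ζ₂₇⁻¹` is NOT in the first layer**: for a cyclotomic `κ` there is `σ ∈ κ.layerSubgroup 1`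
with `σ θ₂ ≠ θ₂` — namely `σ = γ³` for a topological generator `γ` fixing `ζ₃`
(`LayerCharTower.exists_isCyclotomic_isTopGenerator_smul_eq`), which maps `ζ ↦ ζ₃^e ζ` with `e ≢ 0`
(`exists_smul_zeta27_eq`, `pow_three_smul_zeta27_ne`). [cite: Washington1997, §13.1] -/
theorem exists_mem_layerSubgroup_one_smul_theta27_ne {κ : ZpExtension ℚ 3} (hκ : κ.IsCyclotomic)
    {ζ : AlgebraicClosure ℚ} (hζ : IsPrimitiveRoot ζ 27) :
    ∃ σ ∈ κ.layerSubgroup 1, σ • (ζ + ζ ^ 26) ≠ ζ + ζ ^ 26 := by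
  have hζ3 : IsPrimitiveRoot (ζ ^ 9) 3 := hζ.pow (by norm_num) (by norm_num)
  have hζ0 : ζ ≠ 0 := hζ.ne_zero (by norm_num)
  obtain ⟨κ', hκ', hlay, -, γ, hγ, hγN⟩ :=
    LayerCharTower.exists_isCyclotomic_isTopGenerator_smul_eq hκ hζ3
  have hγ3L1 : γ ^ 3 ∈ κ'.layerSubgroup 1 := by
    have h := LayerCharTower.pow_mem_layerSubgroup κ' hγ 1
    rwa [pow_one] at h
  have hγ3N : γ ^ 3 • ζ ^ 9 = ζ ^ 9 := LayerCharTower.pow_smul_eq_self hγN 3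
  obtain ⟨e, -, hγe⟩ := LayerCharTower.exists_smul_zeta27_eq hκ' hζ hγ3L1 hγ3N
  have hmove := LayerCharTower.pow_three_smul_zeta27_ne hκ' hγ hζ
  refine ⟨γ ^ 3, by rw [← hlay]; exact hγ3L1, fun h ↦ ?_⟩
  have h26 : ζ ^ 26 = ζ⁻¹ := eq_inv_of_mul_eq_one_left (by rw [← pow_succ, hζ.pow_eq_one])
  have hx0 : (ζ ^ 9) ^ e * ζ ≠ 0 := mul_ne_zero (pow_ne_zero _ (pow_ne_zero _ hζ0)) hζ0
  rw [h26, smul_add, smul_inv'', hγe] at h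
  rcases eq_or_mul_eq_one_of_add_inv_eq hx0 hζ0 h with h1 | h1
  · exact hmove (by rw [hγe, h1])
  · -- `ζ₃^e ζ² = 1` is impossible: `ζ^{9e+2} = 1` needs `27 ∣ 9e + 2`
    have h2 : ζ ^ (9 * e + 2) = 1 := by rw [pow_add, pow_mul, ← h1]; ring
    have h3 := (hζ.pow_eq_one_iff_dvd _).mp h2
    omega

/-! ### §2 `[ℚ(θ₂) : ℚ] = 9`, `ℚ(θ₂) = ℚ_2`, the minimal polynomial -/

/-- `[ℚ⟮θ₂⟯ : ℚ] = 9` for `θ₂ = ζ + ζ²⁶`, `ζ` a primitive `27`-th root of unity in `ℚ̄`: the degree is a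
multiple of `3 = [ℚ(θ₁):ℚ]` (`θ₁ = θ₂³ − 3θ₂`), divides `9 = [ℚ_2 : ℚ]`, and is not `3` (`θ₂ ∉ ℚ_1`).
[cite: Washington1997, §13.1] -/
theorem finrank_adjoin_theta27 {κ : ZpExtension ℚ 3} (hκ : κ.IsCyclotomic)
    {ζ : AlgebraicClosure ℚ} (hζ : IsPrimitiveRoot ζ 27) :
    Module.finrank ℚ ℚ⟮ζ + ζ ^ 26⟯ = 9 := by
  haveI : Fact (Nat.Prime 3) := ⟨Nat.prime_three⟩
  have hζ9 : IsPrimitiveRoot (ζ ^ 3) 9 := hζ.pow (by norm_num) (by norm_num)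
  -- `ℚ⟮θ₁⟯ ≤ ℚ⟮θ₂⟯ ≤ ℚ_2`
  have hθ₁ : ζ ^ 3 + (ζ ^ 3) ^ 8 ∈ ℚ⟮ζ + ζ ^ 26⟯ := by
    rw [theta9_eq_of_theta27 hζ.pow_eq_one,
      show (3 : AlgebraicClosure ℚ) * (ζ + ζ ^ 26) = (ζ + ζ ^ 26) + (ζ + ζ ^ 26) + (ζ + ζ ^ 26) by ring]
    exact sub_mem (pow_mem (mem_adjoin_simple_self ℚ _) 3)
      (add_mem (add_mem (mem_adjoin_simple_self ℚ _) (mem_adjoin_simple_self ℚ _))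
        (mem_adjoin_simple_self ℚ _))
  have h1le : ℚ⟮ζ ^ 3 + (ζ ^ 3) ^ 8⟯ ≤ ℚ⟮ζ + ζ ^ 26⟯ := adjoin_simple_le_iff.mpr hθ₁
  have h2le : ℚ⟮ζ + ζ ^ 26⟯ ≤ κ.layer 2 :=
    adjoin_simple_le_iff.mpr (zeta_add_pow_mem_layer_two hκ ζ hζ.pow_eq_one)
  haveI : FiniteDimensional ℚ (κ.layer 2) := κ.finiteDimensional_layer_holds 2
  have h9 : Module.finrank ℚ (κ.layer 2) = 9 := (κ.finrank_layer_holds 2).trans (by norm_num)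
  have h3 : Module.finrank ℚ ℚ⟮ζ ^ 3 + (ζ ^ 3) ^ 8⟯ = 3 :=
    KummerLayerClasses.finrank_adjoin_theta (by linear_combination theta_cubic hζ9)
  have hdvd9 : Module.finrank ℚ ℚ⟮ζ + ζ ^ 26⟯ ∣ 9 := by
    obtain ⟨c, hc⟩ := finrank_dvd_of_le_right h2le
    exact ⟨c, h9.symm.trans hc⟩
  have hdvd3 : 3 ∣ Module.finrank ℚ ℚ⟮ζ + ζ ^ 26⟯ := by
    obtain ⟨c, hc⟩ := finrank_dvd_of_le_right h1le
    exact ⟨c, by rw [← h3]; exact hc⟩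
  -- not `3`: else `ℚ⟮θ₂⟯ = ℚ⟮θ₁⟯ = ℚ_1` and `θ₂` would be fixed by `κ⁻¹(3ℤ₃)`
  have hne3 : Module.finrank ℚ ℚ⟮ζ + ζ ^ 26⟯ ≠ 3 := by
    intro h3'
    haveI : FiniteDimensional ℚ ℚ⟮ζ + ζ ^ 26⟯ := Module.finite_of_finrank_eq_succ h3'
    have heq : ℚ⟮ζ ^ 3 + (ζ ^ 3) ^ 8⟯ = ℚ⟮ζ + ζ ^ 26⟯ :=
      eq_of_le_of_finrank_eq h1le (by rw [h3, h3'])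
    have hmem0 : ζ + ζ ^ 26 ∈ ℚ⟮ζ ^ 3 + (ζ ^ 3) ^ 8⟯ := by
      rw [heq]; exact mem_adjoin_simple_self ℚ _
    have hmem : ζ + ζ ^ 26 ∈ κ.layer 1 :=
      (KummerLayerClasses.adjoin_theta_eq_layer_one hκ hζ9).le hmem0
    obtain ⟨σ, hσ, hne⟩ := exists_mem_layerSubgroup_one_smul_theta27_ne hκ hζ
    rw [ZpExtension.layer, IntermediateField.mem_fixedField_iff] at hmem
    exact hne (hmem _ (Subgroup.mem_map.mpr ⟨σ, hσ, rfl⟩))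
  -- divisors of `9` that are multiples of `3`: `3, 9`
  obtain ⟨k, hk⟩ := hdvd3
  rw [hk] at hdvd9 hne3 ⊢
  have hk' : k ∣ 3 := by
    have : 3 * k ∣ 3 * 3 := hdvd9
    exact Nat.dvd_of_mul_dvd_mul_left (by norm_num) this
  rcases (Nat.dvd_prime Nat.prime_three).mp hk' with rfl | rfl
  · exact absurd rfl hne3
  · rfl

/-- **`ℚ⟮θ₂⟯ = ℚ_2`**: the second layer of every cyclotomic `κ : ZpExtension ℚ 3` is `ℚ⟮ζ + ζ²⁶⟯`
(`ζ` a primitive `27`-th root of unity). [cite: Washington1997, §13.1] -/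
theorem adjoin_theta27_eq_layer_two {κ : ZpExtension ℚ 3} (hκ : κ.IsCyclotomic)
    {ζ : AlgebraicClosure ℚ} (hζ : IsPrimitiveRoot ζ 27) : ℚ⟮ζ + ζ ^ 26⟯ = κ.layer 2 := by
  haveI : Fact (Nat.Prime 3) := ⟨Nat.prime_three⟩
  have hle : ℚ⟮ζ + ζ ^ 26⟯ ≤ κ.layer 2 :=
    adjoin_simple_le_iff.mpr (zeta_add_pow_mem_layer_two hκ ζ hζ.pow_eq_one)
  haveI : FiniteDimensional ℚ (κ.layer 2) := κ.finiteDimensional_layer_holds 2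
  have h9 : Module.finrank ℚ (κ.layer 2) = 3 ^ 2 := κ.finrank_layer_holds 2
  refine eq_of_le_of_finrank_eq hle ?_
  rw [finrank_adjoin_theta27 hκ hζ]
  exact (h9.trans (by norm_num)).symm

/-- The nonic as a root statement: `aeval θ₂ f₉ = 0` for
`f₉ = X⁹ − 9X⁷ + 27X⁵ − 30X³ + 9X + 1 ∈ ℤ[X]`. [folklore] -/
theorem aeval_nonic_eq_zero {F : Type*} [Field F] [CharZero F] {ζ : F} (hζ : IsPrimitiveRoot ζ 27) :
    aeval (ζ + ζ ^ 26) (X ^ 9 - 9 * X ^ 7 + 27 * X ^ 5 - 30 * X ^ 3 + 9 * X + 1 : ℤ[X]) = 0 := by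
  simp only [map_add, map_sub, map_mul, map_pow, aeval_X, map_ofNat, map_one]
  exact theta27_nonic hζ

/-- **The minimal polynomial of `θ₂` over `ℚ` is `f₉`** (monic of degree `9 = [ℚ⟮θ₂⟯:ℚ]` and vanishing
at `θ₂`). [cite: Washington1997, §2] -/
theorem minpoly_rat_theta27 {κ : ZpExtension ℚ 3} (hκ : κ.IsCyclotomic)
    {ζ : AlgebraicClosure ℚ} (hζ : IsPrimitiveRoot ζ 27) :
    minpoly ℚ (ζ + ζ ^ 26) =
      Polynomial.map (algebraMap ℤ ℚ) (X ^ 9 - 9 * X ^ 7 + 27 * X ^ 5 - 30 * X ^ 3 + 9 * X + 1) := by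
  set f : ℤ[X] := X ^ 9 - 9 * X ^ 7 + 27 * X ^ 5 - 30 * X ^ 3 + 9 * X + 1 with hf
  have hfm : f.Monic := by rw [hf]; monicity!
  have hfQm : (Polynomial.map (algebraMap ℤ ℚ) f).Monic := hfm.map _
  have hint : IsIntegral ℚ (ζ + ζ ^ 26) :=
    ((hζ.isIntegral (by norm_num)).add ((hζ.isIntegral (by norm_num)).pow 26)).tower_top
  have hroot : aeval (ζ + ζ ^ 26) (Polynomial.map (algebraMap ℤ ℚ) f) = 0 := by
    rw [aeval_map_algebraMap]; exact aeval_nonic_eq_zero hζ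
  -- `minpoly ∣ f`, both monic, `deg minpoly = 9 = deg f`
  have hdvd : minpoly ℚ (ζ + ζ ^ 26) ∣ Polynomial.map (algebraMap ℤ ℚ) f := minpoly.dvd ℚ _ hroot
  have hdegf : (Polynomial.map (algebraMap ℤ ℚ) f).natDegree = 9 := by
    rw [Polynomial.natDegree_map_eq_of_injective (algebraMap ℤ ℚ).injective_int, hf]
    compute_degree!
  have hdegm : (minpoly ℚ (ζ + ζ ^ 26)).natDegree = 9 := by
    rw [← adjoin.finrank hint, finrank_adjoin_theta27 hκ hζ]
  exact (Polynomial.eq_of_monic_of_dvd_of_natDegree_le (minpoly.monic hint) hfQm hdvd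
    (by rw [hdegf, hdegm])).symm

/-- **The minimal polynomial of `θ₂` over `ℤ` is `f₉`.** [cite: Washington1997, §2] -/
theorem minpoly_int_theta27 {κ : ZpExtension ℚ 3} (hκ : κ.IsCyclotomic)
    {ζ : AlgebraicClosure ℚ} (hζ : IsPrimitiveRoot ζ 27) :
    minpoly ℤ (ζ + ζ ^ 26) = X ^ 9 - 9 * X ^ 7 + 27 * X ^ 5 - 30 * X ^ 3 + 9 * X + 1 := by
  have hintZ : IsIntegral ℤ (ζ + ζ ^ 26) :=
    (hζ.isIntegral (by norm_num)).add ((hζ.isIntegral (by norm_num)).pow 26)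
  apply Polynomial.map_injective (algebraMap ℤ ℚ) (algebraMap ℤ ℚ).injective_int
  rw [← minpoly.isIntegrallyClosed_eq_field_fractions' ℚ hintZ, minpoly_rat_theta27 hκ hζ]

/-- **Transfer modulo `q` for `ℤ[θ₂]`**: if `P(θ₂) = Q(θ₂)` (`P, Q ∈ ℤ[X]`) then `P(r) = Q(r)` in any
commutative ring at any `r` with `f₉(r) = 0`. [cite: Washington1997, §2] -/
theorem eval₂_eq_of_aeval_eq_theta27 {κ : ZpExtension ℚ 3} (hκ : κ.IsCyclotomic)
    {ζ : AlgebraicClosure ℚ} (hζ : IsPrimitiveRoot ζ 27) {P Q : ℤ[X]}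
    (h : aeval (ζ + ζ ^ 26) P = aeval (ζ + ζ ^ 26) Q) {S : Type*} [CommRing S] (r : S)
    (hr : r ^ 9 - 9 * r ^ 7 + 27 * r ^ 5 - 30 * r ^ 3 + 9 * r + 1 = 0) :
    P.eval₂ (Int.castRingHom S) r = Q.eval₂ (Int.castRingHom S) r := by
  have h0 : aeval (ζ + ζ ^ 26) (P - Q) = 0 := by rw [map_sub, h, sub_self]
  have hintZ : IsIntegral ℤ (ζ + ζ ^ 26) :=
    (hζ.isIntegral (by norm_num)).add ((hζ.isIntegral (by norm_num)).pow 26)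
  have hdvd : minpoly ℤ (ζ + ζ ^ 26) ∣ P - Q := minpoly.isIntegrallyClosed_dvd hintZ h0
  rw [minpoly_int_theta27 hκ hζ] at hdvd
  obtain ⟨W, hW⟩ := hdvd
  have hf : (X ^ 9 - 9 * X ^ 7 + 27 * X ^ 5 - 30 * X ^ 3 + 9 * X + 1 : ℤ[X]).eval₂ (Int.castRingHom S) r
      = 0 := by
    simp only [eval₂_add, eval₂_sub, eval₂_mul, eval₂_X_pow, eval₂_X, eval₂_one, eval₂_ofNat]
    exact hr
  have e : (P - Q).eval₂ (Int.castRingHom S) r = 0 := by rw [hW, eval₂_mul, hf, zero_mul]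
  rwa [eval₂_sub, sub_eq_zero] at e

/-- **An element of `ℚ̄` fixed by `Gal(ℚ̄/ℚ_2) = κ⁻¹(9ℤ₃)` is `(Σ_{k<9} g_k θ₂^k)/m`** with `g ∈ ℤ⁹`,
`m ≥ 1`. [cite: Washington1997, §13.1] -/
theorem exists_intCombination9_of_fixed {κ : ZpExtension ℚ 3} (hκ : κ.IsCyclotomic)
    {ζ : AlgebraicClosure ℚ} (hζ : IsPrimitiveRoot ζ 27) {γ : AlgebraicClosure ℚ}
    (hγ : ∀ σ ∈ κ.layerSubgroup 2, σ • γ = γ) :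
    ∃ (m : ℕ) (g : Fin 9 → ℤ), 0 < m ∧
      (m : AlgebraicClosure ℚ) * γ = ∑ k : Fin 9, (g k : AlgebraicClosure ℚ) * (ζ + ζ ^ 26) ^ (k : ℕ) := by
  set θ := ζ + ζ ^ 26 with hθdef
  have hint : IsIntegral ℚ θ :=
    ((hζ.isIntegral (by norm_num)).add ((hζ.isIntegral (by norm_num)).pow 26)).tower_top
  have hmem : γ ∈ κ.layer 2 := by
    rw [ZpExtension.layer, IntermediateField.mem_fixedField_iff]
    intro g hg
    obtain ⟨σ, hσ, rfl⟩ := Subgroup.mem_map.mp hg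
    exact hγ σ hσ
  rw [← adjoin_theta27_eq_layer_two hκ hζ] at hmem
  have hmem' : γ ∈ (ℚ⟮θ⟯).toSubalgebra := hmem
  rw [adjoin_simple_toSubalgebra_of_isAlgebraic hint.isAlgebraic,
    Algebra.adjoin_singleton_eq_range_aeval] at hmem'
  obtain ⟨G, hG⟩ := hmem'
  -- reduce modulo the minimal polynomial and clear denominators
  set G' := G %ₘ minpoly ℚ θ with hG'
  have hG'eval : aeval θ G' = γ := by
    rw [hG', modByMonic_eq_sub_mul_div G (minpoly ℚ θ), map_sub, map_mul, minpoly.aeval, zero_mul,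
      sub_zero]
    exact hG
  have hdeg : G'.natDegree < 9 := by
    have hne : minpoly ℚ θ ≠ 1 := minpoly.ne_one ℚ θ
    have h := natDegree_modByMonic_lt G (minpoly.monic hint) hne
    rwa [← adjoin.finrank hint, hθdef, finrank_adjoin_theta27 hκ hζ] at h
  set cf : Fin 9 → ℚ := fun k ↦ G'.coeff k with hcf
  set m : ℕ := ∏ k : Fin 9, (cf k).den with hm
  have hm0 : 0 < m := Finset.prod_pos fun k _ ↦ (cf k).den_pos
  have hdvd : ∀ k : Fin 9, (cf k).den ∣ m := fun k ↦
    Finset.dvd_prod_of_mem (fun k ↦ (cf k).den) (Finset.mem_univ k)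
  refine ⟨m, fun k ↦ ((m / (cf k).den : ℕ) : ℤ) * (cf k).num, hm0, ?_⟩
  rw [← hG'eval, aeval_eq_sum_range' hdeg, Finset.sum_range (fun i ↦ G'.coeff i • θ ^ i),
    Finset.mul_sum]
  refine Finset.sum_congr rfl fun k _ ↦ ?_
  rw [Algebra.smul_def, ← mul_assoc]
  congr 1
  have hq : ((m : ℚ)) * cf k = (((m / (cf k).den : ℕ) : ℤ) * (cf k).num : ℤ) := by
    obtain ⟨t, ht⟩ := hdvd k
    rw [ht, Nat.mul_div_cancel_left _ (cf k).den_pos]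
    push_cast
    rw [mul_comm ((cf k).den : ℚ) (t : ℚ), mul_assoc, Rat.den_mul_eq_num]
  calc (m : AlgebraicClosure ℚ) * algebraMap ℚ (AlgebraicClosure ℚ) (G'.coeff k)
      = algebraMap ℚ (AlgebraicClosure ℚ) ((m : ℚ) * cf k) := by rw [map_mul, map_natCast]
    _ = algebraMap ℚ (AlgebraicClosure ℚ) ((((m / (cf k).den : ℕ) : ℤ) * (cf k).num : ℤ) : ℚ) := by
        rw [hq]
    _ = ((((m / (cf k).den : ℕ) : ℤ) * (cf k).num : ℤ) : AlgebraicClosure ℚ) := by rw [map_intCast]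

end LayerTwoField

end Summit.BirchSwinnertonDyer.Rank1Residual.Additive

end
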